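import Summits.AnomalousDissipation.AnomalousDissipation.Theorems.TaylorCertificatesKolmogorovFloorLineBoundsSizes

/-!
# LINE-BOUNDS (stub of line `Sketch`, crux stmt-AnomalousDissipation-15122)

The theorem `lineBounds`: decay of the closed-form line sequences `x_m, y_m, z_m` like `100Λ⁷Φ/|m|`, the edge
residual `‖Re‖ + ‖Rx‖ + ‖Rn‖ ≤ 1000Λ⁸Φ/(2J+1)` at `m = ±(2J+2)`, and the three window sums. Every symbol is defined in
`TaylorCertificatesKolmogorovFloorResponseDefs` (§3); the sizes of `σ ρ ρ̃ λ± Λ_m y_m inc P`, of `T_m y_m`, and the window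
sums are in the two tool files (`…LineBoundsSums`, `…LineBoundsSizes`).

Proof (finite-sum inequalities only; `Λ ≥ 1` dominates the seven integers and `1/|G|`, `Φ ≥ 0` the force):
* `x, z`: `x_m = (c P_m − a n2 T_m y_m)/D` with `|c| ≤ c²e2 ≤ D`, `|a| n2 ≤ a²n2 ≤ D`, so
  `‖x_m‖ ≤ ‖P_m‖ + ‖T_m y_m‖ ≤ (32Λ⁷ + 16Λ⁵)Φ/|m| ≤ 48Λ⁷Φ/|m|`; the same for `z`; `‖y_m‖ ≤ 8Λ⁴Φ/m² ≤ 8Λ⁴Φ/|m|`.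
* edge `m = ±(2J+2)`: the outer neighbour `±(2J+3)` carries `x = y = z = 0`, the inner one `±(2J+1) = ±M` has
  `‖y‖ ≤ 8Λ⁴Φ/M²`, `‖x‖, ‖z‖ ≤ 48Λ⁷Φ/M`; `‖q_m‖ ≤ 2π|a|X2·‖y‖/N_m ≤ 64Λ⁶Φ/M²` (`N_m ≥ 1`, `π ≤ 4`),
  `|T_m| ≤ Λ + (2J+2)Λ ≤ 3MΛ`; the seven terms of `Re, Rx, Rn` then total `(192+32+64) + (32+192) + (192+64) = 768`
  times `Λ⁸Φ/M ≤ 1000 Λ⁸Φ/M`.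
-/

noncomputable section

set_option linter.dupNamespace false

open Finset
open scoped BigOperators

namespace Summit.AnomalousDissipation.AnomalousDissipation.Theorems.KolmogorovFloor.Response

/-! ## The sequences `x, z` -/

section LineBounds

variable (d : LineData) (F : LineForce) (J : ℕ) {Λ Φ : ℝ}

/-- Common core of the `x, z` bounds: a quotient by `D = c²e2 + a²n2 > 0` of a numerator of size
`≤ u·(P₀/|m|) + v·(T₀/|m|)` with `u, v ≤ D` has size `≤ (P₀ + T₀)/|m|`. -/
theorem norm_div_D_le {P₀ T₀ : ℝ} (hP : ∀ j : ℤ, ‖PC d F J j‖ ≤ P₀ / |(j : ℝ)|)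
    (hTy : ∀ j : ℤ, ‖(d.T j : ℂ) * yC d F J j‖ ≤ T₀ / |(j : ℝ)|)
    (hc1 : 1 ≤ |d.c|) (he2_1 : 1 ≤ d.e2) (hn2_1 : 1 ≤ d.n2) {num : ℂ} {u v : ℝ} {m : ℤ}
    (hnum : ‖num‖ ≤ u * (P₀ / |(m : ℝ)|) + v * (T₀ / |(m : ℝ)|))
    (hu : u ≤ (d.c : ℝ) ^ 2 * d.e2 + (d.a : ℝ) ^ 2 * d.n2)
    (hv : v ≤ (d.c : ℝ) ^ 2 * d.e2 + (d.a : ℝ) ^ 2 * d.n2) :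
    ‖num / (d.D : ℂ)‖ ≤ (P₀ + T₀) / |(m : ℝ)| := by
  have hc' : (1 : ℝ) ≤ |(d.c : ℝ)| := by rw [← Int.cast_abs]; exact_mod_cast hc1
  have he2' : (1 : ℝ) ≤ (d.e2 : ℝ) := by exact_mod_cast he2_1
  have hn2' : (1 : ℝ) ≤ (d.n2 : ℝ) := by exact_mod_cast hn2_1
  have hP0 : 0 ≤ P₀ := le_trans (norm_nonneg _) (by simpa using hP 1)
  have hT0 : 0 ≤ T₀ := by
    have h := hTy 1
    rw [Int.cast_one, abs_one, div_one] at h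
    exact (norm_nonneg _).trans h
  have hc2 : (1 : ℝ) ≤ (d.c : ℝ) ^ 2 := by rw [← sq_abs]; nlinarith
  have hDpos : (0 : ℝ) < (d.c : ℝ) ^ 2 * d.e2 + (d.a : ℝ) ^ 2 * d.n2 := by
    have : (0 : ℝ) ≤ (d.a : ℝ) ^ 2 * d.n2 := by positivity
    nlinarith
  have hD : ‖(d.D : ℂ)‖ = (d.c : ℝ) ^ 2 * d.e2 + (d.a : ℝ) ^ 2 * d.n2 := by
    rw [Complex.norm_intCast, LineData.D]
    push_cast
    exact abs_of_pos hDpos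
  rw [norm_div, hD]
  calc ‖num‖ / ((d.c : ℝ) ^ 2 * d.e2 + (d.a : ℝ) ^ 2 * d.n2)
      ≤ (u * (P₀ / |(m : ℝ)|) + v * (T₀ / |(m : ℝ)|)) / ((d.c : ℝ) ^ 2 * d.e2 + (d.a : ℝ) ^ 2 * d.n2) :=
        div_le_div_of_nonneg_right hnum hDpos.le
    _ ≤ (((d.c : ℝ) ^ 2 * d.e2 + (d.a : ℝ) ^ 2 * d.n2) * (P₀ / |(m : ℝ)|) +
          ((d.c : ℝ) ^ 2 * d.e2 + (d.a : ℝ) ^ 2 * d.n2) * (T₀ / |(m : ℝ)|)) /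
          ((d.c : ℝ) ^ 2 * d.e2 + (d.a : ℝ) ^ 2 * d.n2) :=
        div_le_div_of_nonneg_right (add_le_add (mul_le_mul_of_nonneg_right hu (by positivity))
          (mul_le_mul_of_nonneg_right hv (by positivity))) hDpos.le
    _ = (P₀ + T₀) / |(m : ℝ)| := by
        rw [← mul_add, mul_div_cancel_left₀ _ hDpos.ne', ← add_div]

/-- `‖x_m‖ ≤ (P₀ + T₀)/|m|` from `‖P_j‖ ≤ P₀/|j|`, `‖T_j y_j‖ ≤ T₀/|j|` (`|c| ≤ D`, `|a| n2 ≤ D`). -/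
theorem norm_xC_le_of {P₀ T₀ : ℝ} (hP : ∀ j : ℤ, ‖PC d F J j‖ ≤ P₀ / |(j : ℝ)|)
    (hTy : ∀ j : ℤ, ‖(d.T j : ℂ) * yC d F J j‖ ≤ T₀ / |(j : ℝ)|)
    (ha1 : 1 ≤ |d.a|) (hc1 : 1 ≤ |d.c|) (he2_1 : 1 ≤ d.e2) (hn2_1 : 1 ≤ d.n2) (m : ℤ) :
    ‖xC d F J m‖ ≤ (P₀ + T₀) / |(m : ℝ)| := by
  have ha' : (1 : ℝ) ≤ |(d.a : ℝ)| := by rw [← Int.cast_abs]; exact_mod_cast ha1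
  have hc' : (1 : ℝ) ≤ |(d.c : ℝ)| := by rw [← Int.cast_abs]; exact_mod_cast hc1
  have he2' : (1 : ℝ) ≤ (d.e2 : ℝ) := by exact_mod_cast he2_1
  have hn2' : (1 : ℝ) ≤ (d.n2 : ℝ) := by exact_mod_cast hn2_1
  have hcD : |(d.c : ℝ)| ≤ (d.c : ℝ) ^ 2 * d.e2 + (d.a : ℝ) ^ 2 * d.n2 := by
    have h1 : |(d.c : ℝ)| ≤ (d.c : ℝ) ^ 2 := by rw [← sq_abs]; nlinarith
    have h2 : (d.c : ℝ) ^ 2 ≤ (d.c : ℝ) ^ 2 * d.e2 := le_mul_of_one_le_right (by positivity) he2'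
    have h3 : (0 : ℝ) ≤ (d.a : ℝ) ^ 2 * d.n2 := by positivity
    linarith
  have haD : |(d.a : ℝ)| * |(d.n2 : ℝ)| ≤ (d.c : ℝ) ^ 2 * d.e2 + (d.a : ℝ) ^ 2 * d.n2 := by
    rw [abs_of_pos (show (0 : ℝ) < d.n2 by linarith)]
    have h1 : |(d.a : ℝ)| ≤ (d.a : ℝ) ^ 2 := by rw [← sq_abs]; nlinarith
    have h2 : |(d.a : ℝ)| * (d.n2 : ℝ) ≤ (d.a : ℝ) ^ 2 * d.n2 :=
      mul_le_mul_of_nonneg_right h1 (by linarith)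
    have h3 : (0 : ℝ) ≤ (d.c : ℝ) ^ 2 * d.e2 := by positivity
    linarith
  unfold xC
  refine norm_div_D_le d F J hP hTy hc1 he2_1 hn2_1 ?_ hcD haD
  rw [mul_assoc ((d.a : ℂ) * (d.n2 : ℂ))]
  refine (norm_sub_le _ _).trans (add_le_add ?_ ?_)
  · rw [norm_mul, Complex.norm_intCast]
    exact mul_le_mul_of_nonneg_left (hP m) (abs_nonneg _)
  · rw [norm_mul, norm_mul, Complex.norm_intCast, Complex.norm_intCast]
    exact mul_le_mul_of_nonneg_left (hTy m) (by positivity)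

/-- `‖z_m‖ ≤ (P₀ + T₀)/|m|` from `‖P_j‖ ≤ P₀/|j|`, `‖T_j y_j‖ ≤ T₀/|j|` (`|a| ≤ D`, `|c| e2 ≤ D`). -/
theorem norm_zC_le_of {P₀ T₀ : ℝ} (hP : ∀ j : ℤ, ‖PC d F J j‖ ≤ P₀ / |(j : ℝ)|)
    (hTy : ∀ j : ℤ, ‖(d.T j : ℂ) * yC d F J j‖ ≤ T₀ / |(j : ℝ)|)
    (ha1 : 1 ≤ |d.a|) (hc1 : 1 ≤ |d.c|) (he2_1 : 1 ≤ d.e2) (hn2_1 : 1 ≤ d.n2) (m : ℤ) :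
    ‖zC d F J m‖ ≤ (P₀ + T₀) / |(m : ℝ)| := by
  have ha' : (1 : ℝ) ≤ |(d.a : ℝ)| := by rw [← Int.cast_abs]; exact_mod_cast ha1
  have hc' : (1 : ℝ) ≤ |(d.c : ℝ)| := by rw [← Int.cast_abs]; exact_mod_cast hc1
  have he2' : (1 : ℝ) ≤ (d.e2 : ℝ) := by exact_mod_cast he2_1
  have hn2' : (1 : ℝ) ≤ (d.n2 : ℝ) := by exact_mod_cast hn2_1
  have haD : |(d.a : ℝ)| ≤ (d.c : ℝ) ^ 2 * d.e2 + (d.a : ℝ) ^ 2 * d.n2 := by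
    have h1 : |(d.a : ℝ)| ≤ (d.a : ℝ) ^ 2 := by rw [← sq_abs]; nlinarith
    have h2 : (d.a : ℝ) ^ 2 ≤ (d.a : ℝ) ^ 2 * d.n2 := le_mul_of_one_le_right (by positivity) hn2'
    have h3 : (0 : ℝ) ≤ (d.c : ℝ) ^ 2 * d.e2 := by positivity
    linarith
  have hcD : |(d.c : ℝ)| * |(d.e2 : ℝ)| ≤ (d.c : ℝ) ^ 2 * d.e2 + (d.a : ℝ) ^ 2 * d.n2 := by
    rw [abs_of_pos (show (0 : ℝ) < d.e2 by linarith)]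
    have h1 : |(d.c : ℝ)| ≤ (d.c : ℝ) ^ 2 := by rw [← sq_abs]; nlinarith
    have h2 : |(d.c : ℝ)| * (d.e2 : ℝ) ≤ (d.c : ℝ) ^ 2 * d.e2 :=
      mul_le_mul_of_nonneg_right h1 (by linarith)
    have h3 : (0 : ℝ) ≤ (d.a : ℝ) ^ 2 * d.n2 := by positivity
    linarith
  unfold zC
  refine norm_div_D_le d F J hP hTy hc1 he2_1 hn2_1 ?_ haD hcD
  rw [mul_assoc ((d.c : ℂ) * (d.e2 : ℂ))]
  refine (norm_sub_le _ _).trans (add_le_add ?_ ?_)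
  · rw [norm_neg, norm_mul, Complex.norm_intCast]
    exact mul_le_mul_of_nonneg_left (hP m) (abs_nonneg _)
  · rw [norm_mul, norm_mul, Complex.norm_intCast, Complex.norm_intCast]
    exact mul_le_mul_of_nonneg_left (hTy m) (by positivity)

/-! ## The pressure symbol and the edge residual -/

/-- `‖q_m‖ ≤ 8Λ²·S` from `‖y_{m−1}‖ + ‖y_{m+1}‖ ≤ S` (`N_m ≥ 1`, `π ≤ 4`). -/
theorem norm_qC_le_of {S : ℝ} {m : ℤ} (hS : ‖yC d F J (m - 1)‖ + ‖yC d F J (m + 1)‖ ≤ S)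
    (hΛ : 1 ≤ Λ) (hX2_1 : 1 ≤ d.X2) (ha : (|d.a| : ℝ) ≤ Λ) (hX2 : (d.X2 : ℝ) ≤ Λ)
    (hN : ∀ j : ℤ, 1 ≤ d.N j) : ‖qC d F J m‖ ≤ 8 * Λ ^ 2 * S := by
  have hΛ0 : 0 < Λ := by linarith
  have hX2' : |(d.X2 : ℝ)| ≤ Λ := by
    rwa [abs_of_pos (by exact_mod_cast (show (0 : ℤ) < d.X2 by omega))]
  have hN' : (1 : ℝ) ≤ |(d.N m : ℝ)| := by
    rw [← Int.cast_abs]; exact_mod_cast (hN m).trans (le_abs_self _)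
  have hsum : ‖yC d F J (m - 1) + yC d F J (m + 1)‖ ≤ S := (norm_add_le _ _).trans hS
  have hS0 : 0 ≤ S := le_trans (by positivity) hS
  have hπ4 := Real.pi_le_four
  unfold qC
  rw [norm_div, norm_mul, norm_mul, norm_mul, norm_mul, Complex.norm_two, Complex.norm_real,
    Real.norm_eq_abs, abs_of_pos Real.pi_pos, Complex.norm_intCast, Complex.norm_intCast,
    Complex.norm_intCast]
  calc 2 * Real.pi * |(d.a : ℝ)| * |(d.X2 : ℝ)| * ‖yC d F J (m - 1) + yC d F J (m + 1)‖ / |(d.N m : ℝ)|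
      ≤ 2 * 4 * Λ * Λ * S / 1 := div_le_div₀ (by positivity) (by gcongr) zero_lt_one hN'
    _ = 8 * Λ ^ 2 * S := by ring

/-- The edge estimate in generic form: at a site `m ≠ 0` whose neighbours satisfy
`‖y_{m−1}‖ + ‖y_{m+1}‖ ≤ 8Λ⁴Φ/M²`, `‖x_{m−1}‖ + ‖x_{m+1}‖ ≤ 48Λ⁷Φ/M`, the same for `z`, and
`|T_m| ≤ 3MΛ` (`M ≥ 1`), the three residual components sum to at most `1000Λ⁸Φ/M` (in fact `768`). -/
theorem edge_of {m : ℤ} (hm : m ≠ 0) {M : ℝ} (hM : 1 ≤ M) (hΛ : 1 ≤ Λ) (hΦ : 0 ≤ Φ)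
    (ha : (|d.a| : ℝ) ≤ Λ) (hc : (|d.c| : ℝ) ≤ Λ) (hX2_1 : 1 ≤ d.X2) (he2_1 : 1 ≤ d.e2)
    (hn2_1 : 1 ≤ d.n2) (hX2 : (d.X2 : ℝ) ≤ Λ) (hN : ∀ j : ℤ, 1 ≤ d.N j)
    (hy : ‖yC d F J (m - 1)‖ + ‖yC d F J (m + 1)‖ ≤ 8 * Λ ^ 4 * Φ / M ^ 2)
    (hx : ‖xC d F J (m - 1)‖ + ‖xC d F J (m + 1)‖ ≤ 48 * Λ ^ 7 * Φ / M)
    (hz : ‖zC d F J (m - 1)‖ + ‖zC d F J (m + 1)‖ ≤ 48 * Λ ^ 7 * Φ / M)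
    (hT : |(d.T m : ℝ)| ≤ 3 * M * Λ) :
    ‖ReC d F J m‖ + ‖RxC d F J m‖ + ‖RnC d F J m‖ ≤ 1000 * Λ ^ 8 * Φ / M := by
  have hΛ0 : 0 < Λ := by linarith
  have hM0 : 0 < M := by linarith
  have hX2' : |(d.X2 : ℝ)| ≤ Λ := by
    rwa [abs_of_pos (by exact_mod_cast (show (0 : ℤ) < d.X2 by omega))]
  have hX2one : (1 : ℝ) ≤ |(d.X2 : ℝ)| := by
    rw [abs_of_pos (by exact_mod_cast (show (0 : ℤ) < d.X2 by omega))]; exact_mod_cast hX2_1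
  have he2one : (1 : ℝ) ≤ |(d.e2 : ℝ)| := by
    rw [abs_of_pos (by exact_mod_cast (show (0 : ℤ) < d.e2 by omega))]; exact_mod_cast he2_1
  have hn2one : (1 : ℝ) ≤ |(d.n2 : ℝ)| := by
    rw [abs_of_pos (by exact_mod_cast (show (0 : ℤ) < d.n2 by omega))]; exact_mod_cast hn2_1
  set K := Λ ^ 8 * Φ / M with hK
  have hK0 : 0 ≤ K := by positivity
  have cmp1 : ∀ j : ℕ, j ≤ 8 → Λ ^ j * Φ / M ≤ K := fun j hj => by
    rw [hK]
    gcongr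
  have cmp2 : ∀ j : ℕ, j ≤ 8 → Λ ^ j * Φ / M ^ 2 ≤ K := fun j hj => by
    calc Λ ^ j * Φ / M ^ 2 ≤ Λ ^ j * Φ / M :=
          div_le_div_of_nonneg_left (by positivity) hM0 (by nlinarith)
      _ ≤ K := cmp1 j hj
  have hq : ‖qC d F J m‖ ≤ 8 * Λ ^ 2 * (8 * Λ ^ 4 * Φ / M ^ 2) :=
    norm_qC_le_of d F J hy hΛ hX2_1 ha hX2 hN
  have hq0 : 0 ≤ ‖qC d F J m‖ := norm_nonneg _
  have hπ := Real.pi_pos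
  have hπa : Real.pi * |(d.a : ℝ)| ≤ 4 * Λ := mul_le_mul Real.pi_le_four ha (abs_nonneg _) (by norm_num)
  have hπX : Real.pi * |(d.X2 : ℝ)| ≤ 4 * Λ :=
    mul_le_mul Real.pi_le_four hX2' (abs_nonneg _) (by norm_num)
  -- the seven terms
  have t1 : ‖(Real.pi : ℂ) * (d.a : ℂ) * (xC d F J (m - 1) - xC d F J (m + 1))‖ ≤ 192 * K := by
    rw [norm_mul, norm_mul, Complex.norm_real, Real.norm_eq_abs, abs_of_pos hπ, Complex.norm_intCast]
    calc Real.pi * |(d.a : ℝ)| * ‖xC d F J (m - 1) - xC d F J (m + 1)‖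
        ≤ (4 * Λ) * (48 * Λ ^ 7 * Φ / M) :=
          mul_le_mul hπa ((norm_sub_le _ _).trans hx) (norm_nonneg _) (by positivity)
      _ = 192 * (Λ ^ 8 * Φ / M) := by ring
      _ ≤ 192 * K := by rw [hK]
  have t2 : ‖(Real.pi : ℂ) * (d.X2 : ℂ) * (yC d F J (m - 1) + yC d F J (m + 1))‖ ≤ 32 * K := by
    rw [norm_mul, norm_mul, Complex.norm_real, Real.norm_eq_abs, abs_of_pos hπ, Complex.norm_intCast]
    calc Real.pi * |(d.X2 : ℝ)| * ‖yC d F J (m - 1) + yC d F J (m + 1)‖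
        ≤ (4 * Λ) * (8 * Λ ^ 4 * Φ / M ^ 2) :=
          mul_le_mul hπX ((norm_add_le _ _).trans hy) (norm_nonneg _) (by positivity)
      _ = 32 * (Λ ^ 5 * Φ / M ^ 2) := by ring
      _ ≤ 32 * K := by gcongr; exact cmp2 5 (by norm_num)
  have t3 : ‖qC d F J m * (d.a : ℂ) / (d.e2 : ℂ)‖ ≤ 64 * K := by
    rw [norm_div, norm_mul, Complex.norm_intCast, Complex.norm_intCast]
    calc ‖qC d F J m‖ * |(d.a : ℝ)| / |(d.e2 : ℝ)| ≤ ‖qC d F J m‖ * |(d.a : ℝ)| :=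
          div_le_self (by positivity) he2one
      _ ≤ (8 * Λ ^ 2 * (8 * Λ ^ 4 * Φ / M ^ 2)) * Λ := mul_le_mul hq ha (abs_nonneg _) (by positivity)
      _ = 64 * (Λ ^ 7 * Φ / M ^ 2) := by ring
      _ ≤ 64 * K := by gcongr; exact cmp2 7 (by norm_num)
  have t4 : ‖(Real.pi : ℂ) * (d.a : ℂ) * (yC d F J (m - 1) - yC d F J (m + 1))‖ ≤ 32 * K := by
    rw [norm_mul, norm_mul, Complex.norm_real, Real.norm_eq_abs, abs_of_pos hπ, Complex.norm_intCast]
    calc Real.pi * |(d.a : ℝ)| * ‖yC d F J (m - 1) - yC d F J (m + 1)‖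
        ≤ (4 * Λ) * (8 * Λ ^ 4 * Φ / M ^ 2) :=
          mul_le_mul hπa ((norm_sub_le _ _).trans hy) (norm_nonneg _) (by positivity)
      _ = 32 * (Λ ^ 5 * Φ / M ^ 2) := by ring
      _ ≤ 32 * K := by gcongr; exact cmp2 5 (by norm_num)
  have t5 : ‖qC d F J m * (d.T m : ℂ) / (d.X2 : ℂ)‖ ≤ 192 * K := by
    rw [norm_div, norm_mul, Complex.norm_intCast, Complex.norm_intCast]
    calc ‖qC d F J m‖ * |(d.T m : ℝ)| / |(d.X2 : ℝ)| ≤ ‖qC d F J m‖ * |(d.T m : ℝ)| :=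
          div_le_self (by positivity) hX2one
      _ ≤ (8 * Λ ^ 2 * (8 * Λ ^ 4 * Φ / M ^ 2)) * (3 * M * Λ) :=
          mul_le_mul hq hT (abs_nonneg _) (by positivity)
      _ = 192 * (Λ ^ 7 * Φ / M) := by field_simp; ring
      _ ≤ 192 * K := by gcongr; exact cmp1 7 (by norm_num)
  have t6 : ‖(Real.pi : ℂ) * (d.a : ℂ) * (zC d F J (m - 1) - zC d F J (m + 1))‖ ≤ 192 * K := by
    rw [norm_mul, norm_mul, Complex.norm_real, Real.norm_eq_abs, abs_of_pos hπ, Complex.norm_intCast]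
    calc Real.pi * |(d.a : ℝ)| * ‖zC d F J (m - 1) - zC d F J (m + 1)‖
        ≤ (4 * Λ) * (48 * Λ ^ 7 * Φ / M) :=
          mul_le_mul hπa ((norm_sub_le _ _).trans hz) (norm_nonneg _) (by positivity)
      _ = 192 * (Λ ^ 8 * Φ / M) := by ring
      _ ≤ 192 * K := by rw [hK]
  have t7 : ‖qC d F J m * (d.c : ℂ) / (d.n2 : ℂ)‖ ≤ 64 * K := by
    rw [norm_div, norm_mul, Complex.norm_intCast, Complex.norm_intCast]
    calc ‖qC d F J m‖ * |(d.c : ℝ)| / |(d.n2 : ℝ)| ≤ ‖qC d F J m‖ * |(d.c : ℝ)| :=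
          div_le_self (by positivity) hn2one
      _ ≤ (8 * Λ ^ 2 * (8 * Λ ^ 4 * Φ / M ^ 2)) * Λ := mul_le_mul hq hc (abs_nonneg _) (by positivity)
      _ = 64 * (Λ ^ 7 * Φ / M ^ 2) := by ring
      _ ≤ 64 * K := by gcongr; exact cmp2 7 (by norm_num)
  -- the three components
  have hRe : ‖ReC d F J m‖ ≤ 192 * K + 32 * K + 64 * K := by
    unfold ReC
    rw [if_neg hm, sub_zero]
    refine (norm_sub_le _ _).trans (add_le_add ((norm_add_le _ _).trans (add_le_add t1 t2)) t3)
  have hRx : ‖RxC d F J m‖ ≤ 32 * K + 192 * K := by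
    unfold RxC
    rw [if_neg hm, sub_zero]
    exact (norm_sub_le _ _).trans (add_le_add t4 t5)
  have hRn : ‖RnC d F J m‖ ≤ 192 * K + 64 * K := by
    unfold RnC
    rw [if_neg hm, sub_zero]
    exact (norm_sub_le _ _).trans (add_le_add t6 t7)
  have : 1000 * Λ ^ 8 * Φ / M = 1000 * K := by rw [hK]; ring
  rw [this]
  linarith

end LineBounds

/-! ## The stub -/

/-- **LINE-BOUNDS.** With `Λ ≥ 1` dominating the seven integers and `1/|G|`, and `Φ ≥ 0` the force components:
`|x_m|, |y_m|, |z_m| ≤ 100 Λ⁷ Φ/|m|`, the edge residual components sum to `≤ 1000 Λ⁸ Φ/(2J+1)`, and the three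
window sums `Σ 1/|m| ≤ 2(1+log(2J+1))`, `Σ 1/m² ≤ 4`, `#window = 2J+2`. -/
theorem lineBounds : ∀ (d : LineData) (F : LineForce) (J : ℕ) (Λ Φ : ℝ), 1 ≤ Λ → 0 ≤ Φ →
    1 ≤ |d.a| → 1 ≤ |d.c| → 1 ≤ d.K → 1 ≤ d.X2 → 1 ≤ d.e2 → 1 ≤ d.n2 →
    (|d.a| : ℝ) ≤ Λ → (|d.c| : ℝ) ≤ Λ → (|d.s| : ℝ) ≤ Λ → (d.K : ℝ) ≤ Λ → (d.X2 : ℝ) ≤ Λ →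
    (d.e2 : ℝ) ≤ Λ → (d.n2 : ℝ) ≤ Λ → Λ⁻¹ ≤ |d.G J| →
    (∀ m : ℤ, m % 2 = 1 → d.E m ≠ 0) → (∀ m : ℤ, 3 ≤ |m| → m ^ 2 * d.X2 ≤ 4 * d.E m) →
    (∀ m : ℤ, 1 ≤ d.N m) → (∀ m : ℤ, 2 ≤ |m| → m ^ 2 * d.X2 ≤ 4 * d.N m) →
    ‖F.ve‖ ≤ Φ → ‖F.vx‖ ≤ Φ → ‖F.vn‖ ≤ Φ →
    (∀ m : ℤ, ‖xC d F J m‖ ≤ 100 * Λ ^ 7 * Φ / |(m : ℝ)| ∧ ‖yC d F J m‖ ≤ 100 * Λ ^ 7 * Φ / |(m : ℝ)| ∧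
      ‖zC d F J m‖ ≤ 100 * Λ ^ 7 * Φ / |(m : ℝ)|) ∧
    (∀ m : ℤ, |m| = 2 * (J : ℤ) + 2 →
      ‖ReC d F J m‖ + ‖RxC d F J m‖ + ‖RnC d F J m‖ ≤ 1000 * Λ ^ 8 * Φ / (2 * (J : ℝ) + 1)) ∧
    (∑ m ∈ oddWindow J, (1 : ℝ) / |(m : ℝ)| ≤ 2 * (1 + Real.log (2 * (J : ℝ) + 1))) ∧
    (∑ m ∈ oddWindow J, (1 : ℝ) / (m : ℝ) ^ 2 ≤ 4) ∧ ((oddWindow J).card = 2 * J + 2) := by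
  intro d F J Λ Φ hΛ hΦ ha1 hc1 hK1 hX2_1 he2_1 hn2_1 ha hc hs hK hX2 he2 hn2 hG hE hE3 hN _hN2 hve hvx hvn
  have hΛ0 : 0 < Λ := by linarith
  have hJ : (0 : ℝ) ≤ J := J.cast_nonneg
  -- `y`
  have hy : ∀ m : ℤ, ‖yC d F J m‖ ≤ 8 * Λ ^ 4 * Φ / (m : ℝ) ^ 2 :=
    norm_yC_le d F J hΛ hΦ ha1 hc1 hK1 hX2_1 he2_1 hn2_1 ha hc hK he2 hn2 hG hE hE3 hve hvx hvn
  -- `P`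
  have hP : ∀ m : ℤ, ‖PC d F J m‖ ≤ 32 * Λ ^ 7 * Φ / |(m : ℝ)| := by
    intro m
    have h := norm_PC_le_of d F J (Y := 8 * Λ ^ 4 * Φ) (by positivity) hy hΛ ha1 hX2_1 he2_1 hc hX2 he2 m
    calc ‖PC d F J m‖ ≤ 4 * Λ ^ 3 * (8 * Λ ^ 4 * Φ) / |(m : ℝ)| := h
      _ = 32 * Λ ^ 7 * Φ / |(m : ℝ)| := by ring
  -- `T y`
  have hTy : ∀ m : ℤ, ‖(d.T m : ℂ) * yC d F J m‖ ≤ 16 * Λ ^ 5 * Φ / |(m : ℝ)| := by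
    intro m
    have h := norm_T_mul_yC_le_of d F J (Y := 8 * Λ ^ 4 * Φ) (by positivity) hy hΛ hX2_1 hs hX2 m
    calc ‖(d.T m : ℂ) * yC d F J m‖ ≤ 2 * Λ * (8 * Λ ^ 4 * Φ) / |(m : ℝ)| := h
      _ = 16 * Λ ^ 5 * Φ / |(m : ℝ)| := by ring
  -- `x`, `z`
  have h57 : Λ ^ 5 * Φ ≤ Λ ^ 7 * Φ :=
    mul_le_mul_of_nonneg_right (pow_le_pow_right₀ hΛ (by norm_num)) hΦ
  have h47 : Λ ^ 4 * Φ ≤ Λ ^ 7 * Φ :=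
    mul_le_mul_of_nonneg_right (pow_le_pow_right₀ hΛ (by norm_num)) hΦ
  have hx : ∀ m : ℤ, ‖xC d F J m‖ ≤ 48 * Λ ^ 7 * Φ / |(m : ℝ)| := by
    intro m
    refine (norm_xC_le_of d F J hP hTy ha1 hc1 he2_1 hn2_1 m).trans
      (div_le_div_of_nonneg_right ?_ (abs_nonneg _))
    linarith
  have hz : ∀ m : ℤ, ‖zC d F J m‖ ≤ 48 * Λ ^ 7 * Φ / |(m : ℝ)| := by
    intro m
    refine (norm_zC_le_of d F J hP hTy ha1 hc1 he2_1 hn2_1 m).trans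
      (div_le_div_of_nonneg_right ?_ (abs_nonneg _))
    linarith
  refine ⟨?_, ?_, sum_oddWindow_inv_abs_le J, sum_oddWindow_inv_sq_le J, card_oddWindow J⟩
  · -- decay of `x, y, z`
    intro m
    have h70 : 0 ≤ Λ ^ 7 * Φ := by positivity
    have h100 : 48 * Λ ^ 7 * Φ / |(m : ℝ)| ≤ 100 * Λ ^ 7 * Φ / |(m : ℝ)| :=
      div_le_div_of_nonneg_right (by linarith) (abs_nonneg _)
    have hy100 : 8 * Λ ^ 4 * Φ / (m : ℝ) ^ 2 ≤ 100 * Λ ^ 7 * Φ / |(m : ℝ)| := by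
      rcases eq_or_ne m 0 with rfl | hm
      · simp
      · have hm1 : (1 : ℝ) ≤ |(m : ℝ)| := by
          rw [← Int.cast_abs]; exact_mod_cast Int.one_le_abs hm
        calc 8 * Λ ^ 4 * Φ / (m : ℝ) ^ 2 = 8 * Λ ^ 4 * Φ / (|(m : ℝ)| * |(m : ℝ)|) := by
              rw [← sq_abs, sq]
          _ ≤ 8 * Λ ^ 4 * Φ / (|(m : ℝ)| * 1) :=
              div_le_div_of_nonneg_left (by positivity) (by positivity) (by gcongr)
          _ = 8 * Λ ^ 4 * Φ / |(m : ℝ)| := by rw [mul_one]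
          _ ≤ 100 * Λ ^ 7 * Φ / |(m : ℝ)| := div_le_div_of_nonneg_right (by linarith) (abs_nonneg _)
    exact ⟨(hx m).trans h100, (hy m).trans hy100, (hz m).trans h100⟩
  · -- the edge sites `m = ±(2J+2)`
    intro m hm
    have hM : (1 : ℝ) ≤ 2 * (J : ℝ) + 1 := by linarith
    have hm0 : m ≠ 0 := by
      intro h0
      rw [h0, abs_zero] at hm
      omega
    have hX2' : |(d.X2 : ℝ)| ≤ Λ := by
      rwa [abs_of_pos (by exact_mod_cast (show (0 : ℤ) < d.X2 by omega))]
    have hmabs : |(m : ℝ)| = 2 * (J : ℝ) + 2 := by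
      rw [← Int.cast_abs, hm]; push_cast; ring
    have hT : |(d.T m : ℝ)| ≤ 3 * (2 * (J : ℝ) + 1) * Λ := by
      rw [LineData.T]
      push_cast
      calc |(d.s : ℝ) + (m : ℝ) * (d.X2 : ℝ)| ≤ |(d.s : ℝ)| + |(m : ℝ)| * |(d.X2 : ℝ)| := by
            refine (abs_add_le _ _).trans ?_
            rw [abs_mul]
        _ ≤ Λ + (2 * (J : ℝ) + 2) * Λ := by rw [hmabs]; gcongr
        _ ≤ 3 * (2 * (J : ℝ) + 1) * Λ := by nlinarith
    have hm' : m = 2 * (J : ℤ) + 2 ∨ m = -(2 * (J : ℤ) + 2) := by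
      rcases le_or_gt 0 m with h | h
      · rw [abs_of_nonneg h] at hm; exact Or.inl hm
      · rw [abs_of_neg h] at hm; right; omega
    rcases hm' with rfl | rfl
    · -- right edge: the outer neighbour `2J+3` carries nothing
      have hout : 2 * (J : ℤ) + 2 < |2 * (J : ℤ) + 2 + 1| := by
        rw [abs_of_nonneg (by positivity)]; omega
      have e1 : ((2 * (J : ℤ) + 2 - 1 : ℤ) : ℝ) = 2 * (J : ℝ) + 1 := by push_cast; ring
      have e2 : |((2 * (J : ℤ) + 2 - 1 : ℤ) : ℝ)| = 2 * (J : ℝ) + 1 := by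
        rw [e1]; exact abs_of_pos (by linarith)
      refine edge_of d F J hm0 hM hΛ hΦ ha hc hX2_1 he2_1 hn2_1 hX2 hN ?_ ?_ ?_ hT
      · rw [yC_eq_zero_of_lt d F J (lt_trans (by linarith) hout), norm_zero, add_zero]
        have h := hy (2 * (J : ℤ) + 2 - 1)
        rwa [e1] at h
      · rw [xC_eq_zero_of_lt d F J hout, norm_zero, add_zero]
        have h := hx (2 * (J : ℤ) + 2 - 1)
        rwa [e2] at h
      · rw [zC_eq_zero_of_lt d F J hout, norm_zero, add_zero]
        have h := hz (2 * (J : ℤ) + 2 - 1)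
        rwa [e2] at h
    · -- left edge: the outer neighbour `-(2J+3)` carries nothing
      have hout : 2 * (J : ℤ) + 2 < |-(2 * (J : ℤ) + 2) - 1| := by
        rw [abs_of_neg (by omega)]; omega
      have e1 : ((-(2 * (J : ℤ) + 2) + 1 : ℤ) : ℝ) ^ 2 = (2 * (J : ℝ) + 1) ^ 2 := by push_cast; ring
      have e2 : |((-(2 * (J : ℤ) + 2) + 1 : ℤ) : ℝ)| = 2 * (J : ℝ) + 1 := by
        rw [abs_of_neg (by push_cast; linarith)]; push_cast; ring
      refine edge_of d F J hm0 hM hΛ hΦ ha hc hX2_1 he2_1 hn2_1 hX2 hN ?_ ?_ ?_ hT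
      · rw [yC_eq_zero_of_lt d F J (lt_trans (by linarith) hout), norm_zero, zero_add]
        have h := hy (-(2 * (J : ℤ) + 2) + 1)
        rwa [e1] at h
      · rw [xC_eq_zero_of_lt d F J hout, norm_zero, zero_add]
        have h := hx (-(2 * (J : ℤ) + 2) + 1)
        rwa [e2] at h
      · rw [zC_eq_zero_of_lt d F J hout, norm_zero, zero_add]
        have h := hz (-(2 * (J : ℤ) + 2) + 1)
        rwa [e2] at h

end Summit.AnomalousDissipation.AnomalousDissipation.Theorems.KolmogorovFloor.Response
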